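import Mathlib.FieldTheory.IsAlgClosed.AlgebraicClosure
import Mathlib.Algebra.MvPolynomial.Funext
import Mathlib.Data.ZMod.QuotientGroup
import Mathlib.Algebra.Polynomial.Roots
import Literature.Computability.AlgebraicComplexity.BI17FundamentalInvariantForms
import Literature.Computability.AlgebraicComplexity.LR17EquivariantRepresentations
import Literature.AlgebraicGeometry.Motives.HypersurfaceFormsNonsingular
import HarnessLib

/-!
# Generic hypersurfaces have no linear automorphisms (Poonen 2005, Theorems 2–4)

B. Poonen, *Varieties without extra automorphisms III: hypersurfaces*, Finite Fields Appl. **11**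
(2005) 230–268, doi:10.1016/j.ffa.2004.12.001 [Poonen2005] (held text
`paper:doi-10-1016-j-ffa-2004-12-001`, chunk locators `pNNNN:Lnn` = files `pNNNN.txt`, line `nn`).
Typed literature for the cell `val-lit` (cross-ladder typing seat x3, rung V3): the classical
input "almost all forms of degree `D > 2` in `m > 3` variables have a trivial stabilizer"
(Matsumura–Monsky 1964 [MatsumuraMonsky1963, Thm. 2, not held]) quoted by Bürgisser–Ikenmeyer
2017 §2.1 and vendored in the tree as the open fact `BI2017_matsumuraMonsky_trivialStabilizer`
(`BI17FundamentalInvariantForms.lean`), in the sharper published form of Poonen's Theorem 3,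
which also covers plane curves of degree `d ≥ 4` (the case behind the cell's erratum A21 on
BI 2017 Thm. 2.3). Honest framing: nothing here bears on VP versus VNP; typed ≠ proved.

## Setting of the paper (p0002:L3) and dictionary

"Let `k` be a field … Let `X` in `ℙ^{n+1}` be a smooth hypersurface of degree `d` defined over `k`.
Denote by `Aut X` the group of automorphisms of `X` over an algebraic closure `k̄`. Call
`γ ∈ Aut X` *linear* … if `γ` is induced by an automorphism of `ℙ^{n+1}` over `k̄`, i.e., by a
linear transformation of the homogeneous coordinates. The linear automorphisms form a subgroup
`Lin X` of `Aut X`." In the tree a hypersurface of degree `d` in `ℙ^{n+1}` is a form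
`f : MvPolynomial (Fin (n + 2)) k`, `f.IsHomogeneous d`; "smooth" is the projective Jacobian
criterion `IsNonsingularForm k f` (`Literature.AlgebraicGeometry.Motives.SmoothHypersurface`,
Hartshorne I Ex. 5.8; it forces `f ≠ 0`, `ne_zero_of_isNonsingularForm`); a linear transformation
`γ ∈ GL_{n+2}(K)` induces an automorphism of `X = V(f)` iff `f ∘ γ = α f` for a scalar `α ≠ 0`
(the paper's eq. (7), p0007: "`f(x_0, …, x_{n+1}) = α f(y_0, …, y_{n+1})` for some nonzero scalar
`α`"), i.e. iff `γ ∈ projLinStabilizer f` (the tree's `𝔾_f`, `LR17EquivariantRepresentations.lean`),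
so `Lin X = 𝔾_f(k̄) / k̄^×` and

* "`Lin X = {1}`" is `HasTrivialLinAut f` (over `k̄`): every element of `𝔾_f` is a scalar matrix;
* "`Lin X` is finite" is: `𝔾_f(k̄)` consists of the scalar multiples of finitely many matrices.

Statements about `X` over `k` with `Lin` taken over `k̄` depend only on `X_{k̄}`; Theorems 2 and 3
are therefore typed for forms over an algebraically closed field `K` (any characteristic, as in
the paper), Theorem 4 (existence over EVERY field `k`) for forms over `k` with `Lin` over
`AlgebraicClosure k`. Over an algebraically closed field the dictionary to BI 2017's stabilizer
language is PROVED here: `𝔾_f = K^× · stab(f)` for a form of degree `d ≥ 1`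
(`exists_smul_mem_linStabilizer_of_mem_projLinStabilizer`, rescale by a `d`-th root of `α`) and
`Lin X_f = {1} ↔ stab(f) = μ_d · I` (`hasTrivialLinAut_iff_hasTrivialStabilizer`, BI's
`HasTrivialStabilizer`).

## Coverage (source item → declaration → status), faithfulness sheet

* Thm. 1 (p0002:L5; `Aut X = Lin X` unless `(n,d) ∈ {(1,3),(2,4)}`, [MM Thm. 2], [Ch]) — NOT TYPED
  (no tree rendering of the abstract automorphism group `Aut X` of the embedded hypersurface;
  bears on no open fact of the cell).
* Thm. 2 (p0002:L9; "If `n ≥ 1` and `d ≥ 3`, then `Lin X` is finite") → `poonen2005_thm_2` FACT —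
  FAITHFUL (geometric form: `K` algebraically closed; "finite" = finitely many elements of `𝔾_f`
  up to scalars); PROVED bridge to BI 2017's language `poonen2005_thm_2.finite_linStabilizer`
  (`stab(f)` finite, via `finite_linStabilizer_of_finite_upToScalars`) and
  `poonen2005_thm_2.exists_finite_linStabilizer` (the Fermat form: second clause of BI Thm. 2.3 for
  `m ≥ 3`, conditionally on the typed Thm. 2); `HasTrivialStabilizer.finite_linStabilizer` and
  `poonen2005_thm_3.isZariskiGeneric_finite_linStabilizer` (almost all forms have a finite stabilizer,
  `D, m ≥ 3`, `(D,m) ≠ (3,3)`: the genericity half of BI Thm. 2.3's first sentence, conditionally on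
  the typed Thm. 3). A held proof source for Thm. 3 over `ℂ` with a full proof is Huybrechts, *The
  geometry of cubic hypersurfaces* (2023), Thm. 3.15 (cell lit desk).
* `H_{n,d}`, `U_{n,d}` (p0002:L17; Katz–Sarnak [KS, Lemma 11.8.5]: the smooth hypersurfaces with
  `Lin X = {1}` form an OPEN subset `U_{n,d}` of the projective space `ℙ^{N-1}` of degree-`d`
  forms) and Thm. 3 (p0002:L19; "Suppose that `n ≥ 1`, `d ≥ 3`, and `(n,d) ≠ (1,3)`. Then
  `U_{n,d}` is nonempty. In other words, the generic hypersurface `X` of degree `d` in `ℙ^{n+1}`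
  has `Lin X = {1}`") → `poonen2005_thm_3` FACT — FAITHFUL (rendered with BI 2017's
  `IsZariskiGeneric d`: a nonzero polynomial in the coefficients off whose zero set the form is
  nonsingular with `Lin X = {1}`, which is exactly "`U_{n,d}` is open [KS 11.8.5] and nonempty
  [Thm. 3]" over an algebraically closed field; all characteristics, as printed: [MM] for
  `n ≥ 2`, [Ch] (`p = 0`) and [KS, 10.6.18] (any `p`) for `n = 1`, `d ≥ 4`).
* Lang–Weil remark (p0002:L23; `#k > N_{n,d}` suffices) — NOT TYPED (superseded by Thm. 4).
* Thm. 4 (p0002:L23; "For any field `k` and integers `n ≥ 1`, `d ≥ 3` with `(n,d) ≠ (1,3)`,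
  there exists a smooth hypersurface `X` over `k` of degree `d` in `ℙ^{n+1}` such that
  `Lin X = {1}`") → `poonen2005_thm_4` FACT — FAITHFUL (the explicit `f` of the paper's Table 1
  is the proof, not the statement, and is not typed: the held text drops the displayed table).
* Remarks after Thm. 4 (necessity of `(n,d) ≠ (1,3)`; overlap with [Po1]) and Cor. 5
  (p0002:L27–29; `Aut X = {1}`, needs `Aut`) — NOT TYPED.
* PROVED bridges (no new facts): `poonen2005_thm_3.isZariskiGeneric_hasTrivialStabilizer`
  (generic forms of degree `D ≥ 3` in `m ≥ 3` variables, `(D,m) ≠ (3,3)`, have trivial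
  stabilizer, over any algebraically closed field),
  `BI2017_matsumuraMonsky_trivialStabilizer_of_poonen2005_thm_3` (the BI 2017 §2.1 quotation of
  Matsumura–Monsky, `D > 2`, `m > 3`, is the sub-case `n ≥ 2` — so that open fact is now
  dischargeable BY NAME from the typed primary-source statement),
  `reducedStabilizerPeriod_eq_one_of_hasTrivialStabilizer` (BI §2.1 L466: a trivial stabilizer
  "implies `a'(D,m) = 1`"), `poonen2005_thm_3.isZariskiGeneric_reducedStabilizerPeriod_eq_one`,
  and the cell's erratum **A21** made checkable:
  `isZariskiGeneric_hasTrivialStabilizer_ternaryQuartic_of_poonen2005_thm_3` (generic plane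
  quartics, `(D,m) = (4,3)` = `(n,d) = (1,4)`, have trivial stabilizer, hence `a'(4,3) = 1`) and
  `not_BI2017_thm_2_3_period_of_poonen2005_thm_3`, `not_BI2017_prop_A_5_of_poonen2005_thm_3`:
  CONDITIONALLY ON the typed fact `poonen2005_thm_3`, the clause "`a'(4,3) = 2`" of BI 2017
  Thm. 2.3 / Prop. A.5 (2) AS PRINTED (and as typed verbatim in `BI2017_thm_2_3_period`,
  `BI2017_prop_A_5`) is false — two contradictory Zariski-generic properties of ternary quartics
  cannot coexist over `ℂ` (`IsZariskiGeneric.false_of_disjoint`). This records the literature-certified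
  print-side erratum (lead-bip ruling A21, 2026-08-26); it is not a kernel certificate of
  `¬ BI2017_thm_2_3_period` (that would be a proof of Poonen's theorem for plane quartics).

## References

* B. Poonen, *Varieties without extra automorphisms III: hypersurfaces*, Finite Fields Appl. 11
  (2005) 230–268. [Poonen2005]
* H. Matsumura, P. Monsky, *On the automorphisms of hypersurfaces*, J. Math. Kyoto Univ. 3
  (1963/64) 347–361 (Poonen's [MM]; not held, acq-11400). [MatsumuraMonsky1963]
* N. M. Katz, P. Sarnak, *Random matrices, Frobenius eigenvalues, and monodromy*, AMS Colloquium
  Publ. 45 (1999), Lemma 11.8.5, 10.6.18 (Poonen's [KS]).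
* H. C. Chang, *On plane algebraic curves*, Chinese J. Math. 6 (1978) (Poonen's [Ch]).
* P. Bürgisser, C. Ikenmeyer, *Fundamental invariants of orbit closures*, J. Algebra 477 (2017),
  §2.1 and Thm. 2.3. [BurgisserIkenmeyer2017]

## Tree

`projLinStabilizer`, `mem_projLinStabilizer`, `linStabilizer_le_projLinStabilizer`
(`LR17EquivariantRepresentations`); `linStabilizer`, `mem_linStabilizer` (`EquivariantDC`);
`linSubst`, `linSubst_mul`, `linSubst_one`, `linSubstRep_apply` (`LinSubst`);
`Grenet.linSubst_diagonal_X` (`GrenetEquivariant`); `HasTrivialStabilizer`, `IsZariskiGeneric`,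
`stabilizerDetImage`, `stabilizerPeriod`, `reducedStabilizerPeriod`,
`BI2017_matsumuraMonsky_trivialStabilizer`, `BI2017_thm_2_3_period`, `BI2017_prop_A_5`
(`BI17FundamentalInvariantForms`); `formCoeff`, `DegIdx`, `mem_degMonomials_iff`
(`OrbitCoordinateRing`); `IsNonsingularForm`
(`Literature.AlgebraicGeometry.Motives.HypersurfaceFormsNonsingular`).
-/

noncomputable section

open MvPolynomial

namespace Literature.Computability.AlgebraicComplexity

open Literature.AlgebraicGeometry.Motives.SmoothHypersurface (IsNonsingularForm)

/-! ### `Lin X = {1}` and the dictionary to BI 2017's stabilizer language -/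

section LinAut

variable {σ K : Type*} [Fintype σ] [DecidableEq σ] [Field K]

/-- "`Lin X = {1}`" for the hypersurface `X = V(f) ⊂ ℙ(K^σ)` (Poonen 2005, p0002:L3: the linear
automorphisms of `X` are those "induced by … a linear transformation of the homogeneous
coordinates"; such a transformation `γ` preserves `X` iff `γ · f = α f`, `α ≠ 0`, eq. (7) p0007):
every element of the projective symmetry group `𝔾_f = projLinStabilizer f` is a scalar matrix.
To be read over an algebraically closed field (`Lin X` is taken over `k̄`). [cite: Poonen2005, §1 (p. 230)] -/
def HasTrivialLinAut (f : MvPolynomial σ K) : Prop :=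
  ∀ γ ∈ projLinStabilizer f, ∃ c : K, (γ : Matrix σ σ K) = c • (1 : Matrix σ σ K)

/-- Unfolding lemma for `HasTrivialLinAut`. [cite: Poonen2005, §1 (p. 230)] -/
theorem hasTrivialLinAut_iff (f : MvPolynomial σ K) :
    HasTrivialLinAut f ↔
      ∀ γ ∈ projLinStabilizer f, ∃ c : K, (γ : Matrix σ σ K) = c • (1 : Matrix σ σ K) :=
  Iff.rfl

omit [Fintype σ] [DecidableEq σ] in
/-- Homogeneous polynomials of degree `m` are eigenvectors, with eigenvalue `c ^ m`, of the
substitution `X i ↦ c • X i` (any field). [folklore] -/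
private theorem aeval_smul_X_eq_pow_smul {f : MvPolynomial σ K} {m : ℕ} (hf : f.IsHomogeneous m)
    (c : K) : aeval (fun i => c • (X i : MvPolynomial σ K)) f = c ^ m • f := by
  conv_lhs => rw [f.as_sum]
  conv_rhs => rw [f.as_sum]
  rw [map_sum, Finset.smul_sum]
  refine Finset.sum_congr rfl fun d hd => ?_
  have hdeg : d.degree = m := by
    have := hf (mem_support_iff.mp hd)
    rw [Finsupp.degree_eq_weight_one]
    exact this
  rw [aeval_monomial, monomial_eq, Algebra.algebraMap_eq_smul_one, smul_mul_assoc, one_mul,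
    smul_eq_C_mul, smul_eq_C_mul, ← mul_assoc, ← map_mul, mul_comm (c ^ m)]
  rw [map_mul, mul_assoc]
  congr 1
  rw [Finsupp.prod, Finsupp.prod]
  have : ∀ i ∈ d.support, (c • (X i : MvPolynomial σ K)) ^ d i = C (c ^ d i) * X i ^ d i := by
    intro i _
    rw [smul_eq_C_mul, mul_pow, ← map_pow]
  rw [Finset.prod_congr rfl this, Finset.prod_mul_distrib, ← map_prod, Finset.prod_pow_eq_pow_sum,
    ← Finsupp.degree_apply, hdeg]

/-- Scalar multiples of matrices act on forms of degree `m` by `c ^ m`: `(c • A) · f = c ^ m • (A · f)`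
(any field; the tree's `linSubst_smul_of_isHomogeneous` is the case `K = ℂ`) — BI 2017 §2.1, L428:
"the stabilizer of `w ∈ Sym^D ℂ^m` contains `{ζ I_m | ζ^D = 1}`", i.e. `ζ I` acts on forms of degree
`D` by `ζ^D`. [cite: BurgisserIkenmeyer2017, §2.1 (trivial stabilizer, L428)] -/
theorem linSubst_smul_eq_pow_smul {f : MvPolynomial σ K} {m : ℕ} (hf : f.IsHomogeneous m)
    (c : K) (A : Matrix σ σ K) : linSubst σ K (c • A) f = c ^ m • linSubst σ K A f := by
  have h1 : c • A = A * (c • (1 : Matrix σ σ K)) := by rw [Matrix.mul_smul, Matrix.mul_one]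
  rw [h1, linSubst_mul, AlgHom.comp_apply]
  have h2 : linSubst σ K (c • (1 : Matrix σ σ K)) f = c ^ m • f := by
    rw [Matrix.smul_one_eq_diagonal]
    have : linSubst σ K (Matrix.diagonal fun _ : σ => c) =
        aeval fun i => c • (X i : MvPolynomial σ K) :=
      MvPolynomial.algHom_ext fun i => by rw [Grenet.linSubst_diagonal_X, aeval_X]
    rw [this]
    exact aeval_smul_X_eq_pow_smul hf c
  rw [h2, map_smul]

/-- **`𝔾_f = K^× · stab(f)` over an algebraically closed field**: if `γ · f = α f` (`α ≠ 0`) for a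
form `f` of degree `d ≥ 1`, then `t γ ∈ stab(f)` for a `d`-th root `t` of `α⁻¹`. This is the
dictionary between Poonen's `Lin X` (linear transformations preserving `X = V(f)`, i.e. `f` up to
a scalar, eq. (7) p0007) and BI 2017's stabilizer `stab(f)`. [cite: Poonen2005, §4 eq. (7)] -/
theorem exists_smul_mem_linStabilizer_of_mem_projLinStabilizer [IsAlgClosed K]
    {f : MvPolynomial σ K} {d : ℕ} (hf : f.IsHomogeneous d) (hd : 0 < d) {γ : GL σ K}
    (hγ : γ ∈ projLinStabilizer f) :
    ∃ (t : K) (δ : GL σ K), t ≠ 0 ∧ δ ∈ linStabilizer f ∧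
      (δ : Matrix σ σ K) = t • (γ : Matrix σ σ K) := by
  obtain ⟨α, hα⟩ := hγ
  obtain ⟨t, ht⟩ := IsAlgClosed.exists_pow_nat_eq ((α⁻¹ : Kˣ) : K) hd
  have ht0 : t ≠ 0 := by
    rintro rfl
    rw [zero_pow hd.ne'] at ht
    exact (α⁻¹).ne_zero ht.symm
  have hdet : Matrix.det (t • (γ : Matrix σ σ K)) ≠ 0 := by
    rw [Matrix.det_smul]
    exact mul_ne_zero (pow_ne_zero _ ht0) (Matrix.GeneralLinearGroup.det_ne_zero γ)
  refine ⟨t, Matrix.GeneralLinearGroup.mkOfDetNeZero _ hdet, ht0, ?_, rfl⟩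
  rw [mem_linStabilizer, linSubstRep_apply, Matrix.GeneralLinearGroup.val_mkOfDetNeZero,
    linSubst_smul_eq_pow_smul hf, ht, ← linSubstRep_apply, hα, smul_smul, Units.inv_mul, one_smul]

/-- `Lin X_f = {1}` implies `stab(f) = μ_d · I` for a nonzero form of degree `d` (any field): a
scalar matrix `c I` stabilizes `f` iff `c ^ d = 1`. [cite: Poonen2005, §1 (p. 230)] -/
theorem HasTrivialLinAut.hasTrivialStabilizer {f : MvPolynomial σ K} {d : ℕ}
    (h : HasTrivialLinAut f) (hf : f.IsHomogeneous d) (hf0 : f ≠ 0) :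
    HasTrivialStabilizer d f := by
  intro γ hγ
  obtain ⟨c, hc⟩ := h γ (linStabilizer_le_projLinStabilizer f hγ)
  refine ⟨c, ?_, hc⟩
  rw [mem_linStabilizer, linSubstRep_apply, hc, linSubst_smul_eq_pow_smul hf, linSubst_one,
    AlgHom.id_apply] at hγ
  have h0 : (c ^ d - 1) • f = 0 := by rw [sub_smul, one_smul, hγ, sub_self]
  rwa [smul_eq_zero, or_iff_left hf0, sub_eq_zero] at h0

/-- **Dictionary** (algebraically closed field, nonzero form of degree `d ≥ 1`):
`Lin X_f = {1}` iff `f` has a trivial stabilizer in the sense of BI 2017 §2.1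
(`stab(f) = {ζ I | ζ^d = 1}`). [cite: Poonen2005, §1 (p. 230)] -/
theorem hasTrivialLinAut_iff_hasTrivialStabilizer [IsAlgClosed K] {f : MvPolynomial σ K} {d : ℕ}
    (hf : f.IsHomogeneous d) (hd : 0 < d) (hf0 : f ≠ 0) :
    HasTrivialLinAut f ↔ HasTrivialStabilizer d f := by
  refine ⟨fun h => h.hasTrivialStabilizer hf hf0, fun h γ hγ => ?_⟩
  obtain ⟨t, δ, ht0, hδ, hδγ⟩ := exists_smul_mem_linStabilizer_of_mem_projLinStabilizer hf hd hγ
  obtain ⟨ζ, -, hζ⟩ := h δ hδ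
  refine ⟨t⁻¹ * ζ, ?_⟩
  rw [mul_smul, ← hζ, hδγ, smul_smul, inv_mul_cancel₀ ht0, one_smul]

/-- A nonsingular form is nonzero (the zero ideal of `k[x_0, …, x_{n+1}]` is prime and contains no
variable). [cite: Hartshorne1977, I Ex. 5.8] -/
theorem ne_zero_of_isNonsingularForm {k : Type*} [Field k] {n : ℕ} {F : MvPolynomial (Fin (n + 2)) k}
    (h : IsNonsingularForm k F) : F ≠ 0 := by
  rintro rfl
  have h0 := h ⊥ Ideal.isPrime_bot (Submodule.zero_mem _)
    (fun j => by rw [map_zero]; exact Submodule.zero_mem _) 0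
  exact X_ne_zero (0 : Fin (n + 2)) ((Submodule.mem_bot _).mp h0)

end LinAut

/-! ### Theorems 2, 3, 4 (named facts) -/

section Statements

/-- **Poonen 2005, Thm. 2** (p0002:L9): "If `n ≥ 1` and `d ≥ 3`, then `Lin X` is finite" — for every
smooth hypersurface `X` of degree `d` in `ℙ^{n+1}` over a field `k`, `Lin X` taken over `k̄`
(proof: [OS, Historical Remarks]; [MM] in arbitrary characteristic for `n ≥ 2`; genus `≥ 2` for
`n = 1`, `d ≥ 4`; an elliptic-curve count, `#Lin X ≤ 216`, for `(n,d) = (1,3)`). Typed in the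
geometric form (forms over an algebraically closed field `K`, see the module docstring): the
projective symmetry group `𝔾_f` consists of the scalar multiples of finitely many matrices.
[cite: Poonen2005, Thm. 2] -/
def poonen2005_thm_2 : Prop :=
  ∀ (K : Type) [Field K] [IsAlgClosed K] (n d : ℕ), 1 ≤ n → 3 ≤ d →
    ∀ f : MvPolynomial (Fin (n + 2)) K, f.IsHomogeneous d → IsNonsingularForm K f →
      ∃ T : Finset (GL (Fin (n + 2)) K), ∀ γ ∈ projLinStabilizer f, ∃ t ∈ T, ∃ c : K,
        (γ : Matrix (Fin (n + 2)) (Fin (n + 2)) K) = c • (t : Matrix (Fin (n + 2)) (Fin (n + 2)) K)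

/-- **Poonen 2005, Thm. 3 (Matsumura–Monsky; Chang; Katz–Sarnak)** (p0002:L17–21): for `n ≥ 1`,
`d ≥ 3`, `(n,d) ≠ (1,3)`, "the smooth hypersurfaces `X` with `Lin X = {1}`" correspond to the points
of "an open subset `U_{n,d} ⊂ H_{n,d}`" of the projective space `ℙ^{N-1}` of degree-`d` forms in
`x_0, …, x_{n+1}` [KS, Lemma 11.8.5], and (Thm. 3) "`U_{n,d}` is nonempty. In other words, the
generic hypersurface `X` of degree `d` in `ℙ^{n+1}` has `Lin X = {1}`" ([MM] for `n ≥ 2`, `d ≥ 3`;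
[Ch] for `p = 0` and [KS, 10.6.18] for arbitrary `p` when `n = 1`, `d ≥ 4`; Thm. 4 reproves it).
Rendered with BI 2017's `IsZariskiGeneric d` over an algebraically closed field `K` of any
characteristic: off the zero set of some nonzero polynomial in the coefficients, a form of degree
`d` in `n + 2` variables is nonsingular and has `Lin X = {1}`. [cite: Poonen2005, Thm. 3] -/
def poonen2005_thm_3 : Prop :=
  ∀ (K : Type) [Field K] [IsAlgClosed K] (n d : ℕ), 1 ≤ n → 3 ≤ d → (n, d) ≠ (1, 3) →
    IsZariskiGeneric d fun f : MvPolynomial (Fin (n + 2)) K => IsNonsingularForm K f ∧ HasTrivialLinAut f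

/-- **Poonen 2005, Thm. 4 (main result)** (p0002:L23): "For any field `k` and integers `n ≥ 1`,
`d ≥ 3` with `(n,d) ≠ (1,3)`, there exists a smooth hypersurface `X` over `k` of degree `d` in
`ℙ^{n+1}` such that `Lin X = {1}`" (`Lin X` over `k̄`; the paper's `X` is the explicit form of its
Table 1, depending on `n`, `d` and the characteristic). [cite: Poonen2005, Thm. 4] -/
def poonen2005_thm_4 : Prop :=
  ∀ (k : Type) [Field k] (n d : ℕ), 1 ≤ n → 3 ≤ d → (n, d) ≠ (1, 3) →
    ∃ f : MvPolynomial (Fin (n + 2)) k, f.IsHomogeneous d ∧ IsNonsingularForm k f ∧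
      HasTrivialLinAut (MvPolynomial.map (algebraMap k (AlgebraicClosure k)) f)

end Statements

/-! ### Bridges to BI 2017 §2.1 (proved) -/

section Bridges

/-- **Generic forms have a trivial stabilizer** (from Poonen's Thm. 3, via the dictionary): over an
algebraically closed field, for `D ≥ 3`, `m ≥ 3`, `(D,m) ≠ (3,3)`, almost all forms of degree `D`
in `m` variables have `stab = μ_D · I` (`(n,d) = (m-2, D)`). [cite: Poonen2005, Thm. 3] -/
theorem poonen2005_thm_3.isZariskiGeneric_hasTrivialStabilizer (h : poonen2005_thm_3)
    (K : Type) [Field K] [IsAlgClosed K] {D m : ℕ} (hD : 3 ≤ D) (hm : 3 ≤ m)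
    (h33 : ¬ (D = 3 ∧ m = 3)) :
    IsZariskiGeneric D (HasTrivialStabilizer D : MvPolynomial (Fin m) K → Prop) := by
  obtain ⟨n, rfl⟩ : ∃ n, m = n + 2 := ⟨m - 2, by omega⟩
  have hnd : (n, D) ≠ (1, 3) := by
    intro h13
    simp only [Prod.mk.injEq] at h13
    exact h33 ⟨h13.2, by omega⟩
  obtain ⟨F, hF0, hF⟩ := h K n D (by omega) hD hnd
  refine ⟨F, hF0, fun f hf hFf => ?_⟩
  obtain ⟨hns, hlin⟩ := hF f hf hFf
  exact (hasTrivialLinAut_iff_hasTrivialStabilizer hf (by omega) (ne_zero_of_isNonsingularForm hns)).mp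
    hlin

/-- **BI 2017 §2.1 (Matsumura–Monsky as quoted, L466–468) from Poonen's Thm. 3**: "if `D > 2` and
`m > 3`, then almost all `w ∈ Sym^D ℂ^m` have a trivial stabilizer" is the sub-case `n ≥ 2` of
Thm. 3 over `K = ℂ`; so the open fact `BI2017_matsumuraMonsky_trivialStabilizer` is discharged BY
NAME from `poonen2005_thm_3`. [cite: Poonen2005, Thm. 3] -/
theorem BI2017_matsumuraMonsky_trivialStabilizer_of_poonen2005_thm_3 (h : poonen2005_thm_3) :
    BI2017_matsumuraMonsky_trivialStabilizer := fun _ _ hD hm =>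
  h.isZariskiGeneric_hasTrivialStabilizer ℂ (by omega) (by omega) (by omega)

/-- **Generic plane quartics have a trivial stabilizer** (`(n,d) = (1,4)`, i.e. `(D,m) = (4,3)`, is
inside the range of Thm. 3; the cell's erratum A21 on BI 2017 Thm. 2.3), conditionally on the typed
fact `poonen2005_thm_3`. [cite: Poonen2005, Thm. 3] -/
theorem isZariskiGeneric_hasTrivialStabilizer_ternaryQuartic_of_poonen2005_thm_3
    (h : poonen2005_thm_3) :
    IsZariskiGeneric 4 (HasTrivialStabilizer 4 : MvPolynomial (Fin 3) ℂ → Prop) :=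
  h.isZariskiGeneric_hasTrivialStabilizer ℂ (by omega) (by omega) (by omega)

/-- **A trivial stabilizer forces `a(w) = D / gcd(D,m)`** (BI 2017 §2.1, L466: a trivial stabilizer
"implies `a'(D,m) = 1`"): if `stab(w) = {ζ I | ζ^D = 1}` then `H = det(stab w) = {ζ^m | ζ^D = 1}` is
cyclic of order `D / gcd(D,m)` (cf. the printed proof of Lemma 2.1).
[cite: BurgisserIkenmeyer2017, §2.1 (before Thm. 2.3)] -/
theorem stabilizerPeriod_eq_of_hasTrivialStabilizer {m D : ℕ} {f : MvPolynomial (Fin m) ℂ}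
    (hf : f.IsHomogeneous D) (hD : 0 < D) (htriv : HasTrivialStabilizer D f) :
    stabilizerPeriod f = D / Nat.gcd D m := by
  classical
  -- the primitive `D`-th root of unity `ζ` and the scalar stabilizer element `ζ I`
  set ζ : ℂ := Complex.exp (2 * Real.pi * Complex.I / D) with hζdef
  have hζ : IsPrimitiveRoot ζ D := Complex.isPrimitiveRoot_exp D hD.ne'
  have hζ0 : ζ ≠ 0 := hζ.ne_zero hD.ne'
  have hdet : Matrix.det (ζ • (1 : Matrix (Fin m) (Fin m) ℂ)) = ζ ^ m := by
    rw [Matrix.det_smul, Matrix.det_one, mul_one, Fintype.card_fin]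
  have hdet0 : Matrix.det (ζ • (1 : Matrix (Fin m) (Fin m) ℂ)) ≠ 0 := by
    rw [hdet]; exact pow_ne_zero _ hζ0
  let γ₀ : GL (Fin m) ℂ := Matrix.GeneralLinearGroup.mkOfDetNeZero _ hdet0
  have hγ₀ : γ₀ ∈ linStabilizer f := by
    rw [mem_linStabilizer, linSubstRep_apply, Matrix.GeneralLinearGroup.val_mkOfDetNeZero,
      linSubst_smul_eq_pow_smul hf, linSubst_one, AlgHom.id_apply, hζ.pow_eq_one, one_smul]
  set u₀ : ℂˣ := Matrix.GeneralLinearGroup.det γ₀ with hu₀def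
  have hu₀val : (u₀ : ℂ) = ζ ^ m := by
    rw [hu₀def, Matrix.GeneralLinearGroup.val_det_apply, Matrix.GeneralLinearGroup.val_mkOfDetNeZero]
    exact hdet
  -- `H = ⟨ζ^m⟩`
  have hH : stabilizerDetImage f = Subgroup.zpowers u₀ := by
    apply le_antisymm
    · intro u hu
      obtain ⟨γ, hγ, rfl⟩ := (mem_stabilizerDetImage_iff f u).mp hu
      obtain ⟨η, hηD, hγη⟩ := htriv γ hγ
      haveI : NeZero D := ⟨hD.ne'⟩
      obtain ⟨i, -, hi⟩ := hζ.eq_pow_of_pow_eq_one hηD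
      refine Subgroup.mem_zpowers_iff.mpr ⟨(i : ℤ), ?_⟩
      rw [zpow_natCast]
      apply Units.ext
      rw [Units.val_pow_eq_pow_val, hu₀val, Matrix.GeneralLinearGroup.val_det_apply, hγη,
        Matrix.det_smul, Matrix.det_one, mul_one, Fintype.card_fin, ← hi, ← pow_mul, ← pow_mul,
        mul_comm]
    · rw [Subgroup.zpowers_le]
      exact Subgroup.mem_map_of_mem _ hγ₀
  -- order of `ζ^m`
  rw [stabilizerPeriod, hH, Nat.card_zpowers, ← orderOf_units, hu₀val]
  by_cases hm : m = 0
  · subst hm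
    rw [pow_zero, orderOf_one, Nat.gcd_zero_right, Nat.div_self hD]
  · rw [orderOf_pow' ζ hm, ← hζ.eq_orderOf]

/-- **A trivial stabilizer implies `a'(w) = 1`** (BI 2017 §2.1, L466–468: "… have a trivial
stabilizer, which implies `a'(D,m) = 1`"; `a'(w) = a(w) gcd(D,m) / D`, Def. 2.2).
[cite: BurgisserIkenmeyer2017, §2.1 (before Thm. 2.3)] -/
theorem reducedStabilizerPeriod_eq_one_of_hasTrivialStabilizer {m D : ℕ} {f : MvPolynomial (Fin m) ℂ}
    (hf : f.IsHomogeneous D) (hD : 0 < D) (htriv : HasTrivialStabilizer D f) :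
    reducedStabilizerPeriod D f = 1 := by
  rw [reducedStabilizerPeriod, Fintype.card_fin, stabilizerPeriod_eq_of_hasTrivialStabilizer hf hD htriv,
    Nat.div_mul_cancel (Nat.gcd_dvd_left D m), Nat.div_self hD]

/-- **`a'(D,m) = 1` generically for `D ≥ 3`, `m ≥ 3`, `(D,m) ≠ (3,3)`** — the reading of BI 2017
Thm. 2.3 (second sentence) AS CORRECTED by the literature in the range `m ≥ 3` (erratum A21: the
printed exception "`a'(4,3) = 2`" is not one), conditionally on the typed fact `poonen2005_thm_3`.
[cite: Poonen2005, Thm. 3] -/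
theorem poonen2005_thm_3.isZariskiGeneric_reducedStabilizerPeriod_eq_one (h : poonen2005_thm_3)
    {D m : ℕ} (hD : 3 ≤ D) (hm : 3 ≤ m) (h33 : ¬ (D = 3 ∧ m = 3)) :
    IsZariskiGeneric D fun f : MvPolynomial (Fin m) ℂ => reducedStabilizerPeriod D f = 1 := by
  obtain ⟨F, hF0, hF⟩ := h.isZariskiGeneric_hasTrivialStabilizer ℂ hD hm h33
  exact ⟨F, hF0, fun f hf hFf =>
    reducedStabilizerPeriod_eq_one_of_hasTrivialStabilizer hf (by omega) (hF f hf hFf)⟩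

/-- Every point of `Sym^D K^σ` is the coefficient vector of a form of degree `D` (the sum of its
monomials; cf. the tree's `exists_isHomogeneous_formCoeff_eq` in `FewLetterEquations.lean`, stated
there under a linear order on `σ`). [folklore] -/
private theorem exists_isHomogeneous_formCoeff_eq_of_decEq {σ K : Type*} [Fintype σ] [DecidableEq σ]
    [Field K] {D : ℕ} (c : DegIdx σ D → K) :
    ∃ p : MvPolynomial σ K, p.IsHomogeneous D ∧ formCoeff D p = c := by
  refine ⟨∑ d : DegIdx σ D, monomial d.1 (c d), ?_, ?_⟩
  · exact IsHomogeneous.sum _ _ _ fun d _ =>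
      isHomogeneous_monomial (R := K) (d := d.1) (n := D) (c d) (mem_degMonomials_iff.mp d.2)
  · funext d
    rw [formCoeff_apply, coeff_sum]
    simp only [coeff_monomial]
    rw [Finset.sum_eq_single d (fun e _ hed => if_neg fun h => hed (Subtype.ext h))
      (fun h => absurd (Finset.mem_univ d) h), if_pos rfl]

/-- Over an infinite field two Zariski-generic properties of degree-`D` forms are compatible: a
product of nonzero polynomials in the coefficients is nonzero, does not vanish at some coefficient
vector (the field is infinite), and every coefficient vector is that of a form of degree `D`.
[cite: BurgisserIkenmeyer2017, §2.1 ("almost all")] -/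
theorem IsZariskiGeneric.false_of_disjoint {σ K : Type*} [Fintype σ] [DecidableEq σ] [Field K]
    [Infinite K] {D : ℕ} {P Q : MvPolynomial σ K → Prop} (hP : IsZariskiGeneric D P)
    (hQ : IsZariskiGeneric D Q) (hPQ : ∀ f : MvPolynomial σ K, f.IsHomogeneous D → P f → Q f → False) :
    False := by
  obtain ⟨F, hF0, hF⟩ := hP
  obtain ⟨G, hG0, hG⟩ := hQ
  have hex : ∃ c : DegIdx σ D → K, aeval c (F * G) ≠ 0 := by
    by_contra! hall
    exact mul_ne_zero hF0 hG0 (MvPolynomial.funext fun c => by rw [map_zero]; exact hall c)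
  obtain ⟨c, hc⟩ := hex
  obtain ⟨p, hp, hpc⟩ := exists_isHomogeneous_formCoeff_eq_of_decEq c
  rw [← hpc, map_mul] at hc
  exact hPQ p hp (hF p hp (left_ne_zero_of_mul hc)) (hG p hp (right_ne_zero_of_mul hc))

/-- **Erratum A21, conditionally on `poonen2005_thm_3`: BI 2017 Thm. 2.3's clause "`a'(4,3) = 2`"
is false as printed** — `BI2017_thm_2_3_period` (typed verbatim) asserts that almost all ternary
quartics have `a' = 2`, Poonen's Thm. 3 gives `a' = 1` for almost all of them, and two
contradictory generic properties cannot both hold over `ℂ`. (The other printed values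
`a'(3,2) = a'(3,3) = 2`, `a'(D,m) = 1` otherwise, are not affected.) [cite: Poonen2005, Thm. 3] -/
theorem not_BI2017_thm_2_3_period_of_poonen2005_thm_3 (h : poonen2005_thm_3) :
    ¬ BI2017_thm_2_3_period := by
  intro h23
  have h2 := h23 4 3 (by norm_num) (by norm_num)
  have h1 := h.isZariskiGeneric_reducedStabilizerPeriod_eq_one (D := 4) (m := 3)
    (by norm_num) (by norm_num) (by omega)
  exact h2.false_of_disjoint h1 fun f _ ha hb => by
    rw [hb] at ha
    norm_num at ha

/-- **Erratum A21 for BI 2017 Prop. A.5 (2)** ("for a generic `w ∈ Sym⁴ℂ³` … `a'(4,3) = 2`", typed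
verbatim as the second conjunct of `BI2017_prop_A_5`): false as printed, conditionally on
`poonen2005_thm_3`. [cite: Poonen2005, Thm. 3] -/
theorem not_BI2017_prop_A_5_of_poonen2005_thm_3 (h : poonen2005_thm_3) : ¬ BI2017_prop_A_5 := by
  intro hA5
  have h2 := hA5.2.1
  have h1 := h.isZariskiGeneric_reducedStabilizerPeriod_eq_one (D := 4) (m := 3)
    (by norm_num) (by norm_num) (by omega)
  exact h2.false_of_disjoint h1 fun f _ ha hb => by omega

end Bridges

/-! ### Thm. 2 in BI 2017's language: a finite `Lin X` means a finite stabilizer (proved) -/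

section FiniteStabilizer

variable {σ K : Type*} [Fintype σ] [DecidableEq σ] [Field K]

/-- A scalar matrix `c I` in the stabilizer of a nonzero form of degree `d` has `c ^ d = 1`.
[cite: BurgisserIkenmeyer2017, §2.1 (trivial stabilizer, L428)] -/
theorem pow_eq_one_of_smul_one_mem_linStabilizer {f : MvPolynomial σ K} {d : ℕ}
    (hf : f.IsHomogeneous d) (hf0 : f ≠ 0) {c : K} {γ : GL σ K} (hγ : γ ∈ linStabilizer f)
    (hc : (γ : Matrix σ σ K) = c • (1 : Matrix σ σ K)) : c ^ d = 1 := by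
  rw [mem_linStabilizer, linSubstRep_apply, hc, linSubst_smul_eq_pow_smul hf, linSubst_one,
    AlgHom.id_apply] at hγ
  have h0 : (c ^ d - 1) • f = 0 := by rw [sub_smul, one_smul, hγ, sub_self]
  rwa [smul_eq_zero, or_iff_left hf0, sub_eq_zero] at h0

/-- **"`Lin X` finite" ⇒ "`stab(f)` finite"**: if the projective symmetry group `𝔾_f` of a nonzero form
of degree `d ≥ 1` consists of the scalar multiples of finitely many matrices (the typed form of
Poonen's Thm. 2), then the stabilizer `stab(f) ≤ 𝔾_f` is finite — two stabilizer elements on the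
same line differ by a `d`-th root of unity. [cite: Poonen2005, Thm. 2] -/
theorem finite_linStabilizer_of_finite_upToScalars [Nonempty σ] {f : MvPolynomial σ K} {d : ℕ}
    (hf : f.IsHomogeneous d) (hd : 0 < d) (hf0 : f ≠ 0) (T : Finset (GL σ K))
    (hT : ∀ γ ∈ projLinStabilizer f, ∃ t ∈ T, ∃ c : K, (γ : Matrix σ σ K) = c • (t : Matrix σ σ K)) :
    Finite (linStabilizer f) := by
  classical
  -- the lines through the elements of `T`, intersected with the stabilizer
  let A : GL σ K → Set (GL σ K) := fun t =>
    {γ | γ ∈ linStabilizer f ∧ ∃ c : K, (γ : Matrix σ σ K) = c • (t : Matrix σ σ K)}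
  have hcover : (linStabilizer f : Set (GL σ K)) ⊆ ⋃ t ∈ T, A t := by
    intro γ hγ
    obtain ⟨t, ht, c, hc⟩ := hT γ (linStabilizer_le_projLinStabilizer f hγ)
    exact Set.mem_biUnion ht ⟨hγ, c, hc⟩
  have hfin : ∀ t ∈ T, (A t).Finite := by
    intro t _
    by_cases hne : (A t).Nonempty
    · obtain ⟨γ₀, hγ₀, c₀, hc₀⟩ := hne
      have hc₀0 : c₀ ≠ 0 := by
        rintro rfl
        rw [zero_smul] at hc₀
        exact Matrix.GeneralLinearGroup.det_ne_zero γ₀ (by rw [hc₀, Matrix.det_zero])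
      -- every element of `A t` is `(ζ c₀) • t` with `ζ ^ d = 1`
      have hsub : ((fun γ : GL σ K => (γ : Matrix σ σ K)) '' A t) ⊆
          (fun ζ : K => (ζ * c₀) • (t : Matrix σ σ K)) '' ↑(Polynomial.nthRootsFinset d (1 : K)) := by
        rintro _ ⟨γ, ⟨hγ, c, hc⟩, rfl⟩
        have hδ : γ₀⁻¹ * γ ∈ linStabilizer f :=
          (linStabilizer f).mul_mem ((linStabilizer f).inv_mem hγ₀) hγ
        have hδmat : ((γ₀⁻¹ * γ : GL σ K) : Matrix σ σ K) = (c / c₀) • (1 : Matrix σ σ K) := by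
          have ht : (t : Matrix σ σ K) = c₀⁻¹ • (γ₀ : Matrix σ σ K) := by
            rw [hc₀, smul_smul, inv_mul_cancel₀ hc₀0, one_smul]
          rw [Units.val_mul, hc, ht, Matrix.mul_smul, Matrix.mul_smul, ← Units.val_mul, inv_mul_cancel,
            Units.val_one, smul_smul, div_eq_mul_inv]
        have hroot : (c / c₀) ^ d = 1 := pow_eq_one_of_smul_one_mem_linStabilizer hf hf0 hδ hδmat
        refine ⟨c / c₀, ?_, ?_⟩
        · rw [Finset.mem_coe, Polynomial.mem_nthRootsFinset hd]
          exact hroot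
        · show (c / c₀ * c₀) • (t : Matrix σ σ K) = (γ : Matrix σ σ K)
          rw [div_mul_cancel₀ c hc₀0, hc]
      exact Set.Finite.of_finite_image (((Finset.finite_toSet _).image _).subset hsub)
        fun x _ y _ hxy => Units.ext hxy
    · rw [Set.not_nonempty_iff_eq_empty] at hne
      rw [hne]
      exact Set.finite_empty
  have : (linStabilizer f : Set (GL σ K)).Finite :=
    Set.Finite.subset (Set.Finite.biUnion T.finite_toSet hfin) hcover
  exact this.to_subtype

/-- **Poonen's Thm. 2 in BI 2017's language**: over an algebraically closed field, for `n ≥ 1`, `d ≥ 3`,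
every smooth hypersurface of degree `d` in `ℙ^{n+1}` has a FINITE stabilizer `stab(f)` (from the typed
fact `poonen2005_thm_2`: `Lin X` finite, and two stabilizer elements on a line differ by `μ_d`).
[cite: Poonen2005, Thm. 2] -/
theorem poonen2005_thm_2.finite_linStabilizer (h : poonen2005_thm_2) (K : Type) [Field K]
    [IsAlgClosed K] {n d : ℕ} (hn : 1 ≤ n) (hd : 3 ≤ d) {f : MvPolynomial (Fin (n + 2)) K}
    (hf : f.IsHomogeneous d) (hns : IsNonsingularForm K f) : Finite (linStabilizer f) := by
  obtain ⟨T, hT⟩ := h K n d hn hd f hf hns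
  exact finite_linStabilizer_of_finite_upToScalars hf (by omega) (ne_zero_of_isNonsingularForm hns) T hT

/-- **Forms with a finite stabilizer exist** for `D ≥ 3`, `m ≥ 3` (conditionally on `poonen2005_thm_2`):
the Fermat form `x₁^D + ⋯ + x_m^D` is nonsingular over `ℂ` (the tree's `isNonsingularForm_sum_X_pow`,
Hartshorne I Ex. 5.5), hence has finite `Lin` and finite `stab` — the second clause of BI 2017
Thm. 2.3 (`BI2017_thm_2_3_open`: "the set of `w` with finite stabilizer is … nonempty") for `m ≥ 3`.
[cite: Poonen2005, Thm. 2] -/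
theorem poonen2005_thm_2.exists_finite_linStabilizer (h : poonen2005_thm_2) {D m : ℕ} (hD : 3 ≤ D)
    (hm : 3 ≤ m) : ∃ f : MvPolynomial (Fin m) ℂ, f.IsHomogeneous D ∧ Finite (linStabilizer f) := by
  obtain ⟨n, rfl⟩ : ∃ n, m = n + 2 := ⟨m - 2, by omega⟩
  have hhom : (∑ i : Fin (n + 2), (X i : MvPolynomial (Fin (n + 2)) ℂ) ^ D).IsHomogeneous D :=
    IsHomogeneous.sum _ _ _ fun i _ => isHomogeneous_X_pow i D
  have hD0 : (D : ℂ) ≠ 0 := by exact_mod_cast (show D ≠ 0 by omega)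
  exact ⟨_, hhom, h.finite_linStabilizer ℂ (by omega) hD hhom
    (Literature.AlgebraicGeometry.Motives.SmoothHypersurface.isNonsingularForm_sum_X_pow hD0)⟩

/-- **A trivial stabilizer is finite**: `stab(f) = {ζ I | ζ^d = 1}` has at most `d` elements
(`d ≥ 1`). [cite: BurgisserIkenmeyer2017, §2.1 (trivial stabilizer, L428)] -/
theorem HasTrivialStabilizer.finite_linStabilizer {f : MvPolynomial σ K} {d : ℕ} (hd : 0 < d)
    (h : HasTrivialStabilizer d f) : Finite (linStabilizer f) := by
  classical
  have hsub : ((fun γ : GL σ K => (γ : Matrix σ σ K)) '' (linStabilizer f : Set (GL σ K))) ⊆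
      (fun ζ : K => ζ • (1 : Matrix σ σ K)) '' ↑(Polynomial.nthRootsFinset d (1 : K)) := by
    rintro _ ⟨γ, hγ, rfl⟩
    obtain ⟨ζ, hζ, hγζ⟩ := h γ hγ
    exact ⟨ζ, by rw [Finset.mem_coe, Polynomial.mem_nthRootsFinset hd]; exact hζ, hγζ.symm⟩
  have hfin : (linStabilizer f : Set (GL σ K)).Finite :=
    Set.Finite.of_finite_image (((Finset.finite_toSet _).image _).subset hsub)
      fun x _ y _ hxy => Units.ext hxy
  exact hfin.to_subtype

/-- **Almost all forms have a finite (indeed trivial) stabilizer** for `D ≥ 3`, `m ≥ 3`,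
`(D,m) ≠ (3,3)`, over any algebraically closed field — the genericity half of BI 2017 Thm. 2.3,
first sentence ("the set of `w` with finite stabilizer is a nonempty open subset"), in that range,
conditionally on the typed fact `poonen2005_thm_3`. [cite: Poonen2005, Thm. 3] -/
theorem poonen2005_thm_3.isZariskiGeneric_finite_linStabilizer (h : poonen2005_thm_3)
    (K : Type) [Field K] [IsAlgClosed K] {D m : ℕ} (hD : 3 ≤ D) (hm : 3 ≤ m)
    (h33 : ¬ (D = 3 ∧ m = 3)) :
    IsZariskiGeneric D fun f : MvPolynomial (Fin m) K => Finite (linStabilizer f) := by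
  obtain ⟨F, hF0, hF⟩ := h.isZariskiGeneric_hasTrivialStabilizer K hD hm h33
  exact ⟨F, hF0, fun f hf hFf => (hF f hf hFf).finite_linStabilizer (by omega)⟩

end FiniteStabilizer

end Literature.Computability.AlgebraicComplexity

end
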